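import Literature.Geometry.Symplectic.PALFBoxProduct
import Literature.Geometry.Symplectic.PALFKasCount
import Mathlib.Analysis.Normed.Module.Connected
import Mathlib.Analysis.Normed.Module.Ball.Homeomorph
import HarnessLib

/-!
# Transport of the regular fibre of a Lefschetz fibration over the disc

Topic `Literature/Geometry/Symplectic` (fact seat
`provefact-Literature.Geometry.Symplectic.Oba2016_s-add47373d4`; a brick of the fibre-page statement
`hF` of `kasHandleCount_of_planarFibreMorse`: whatever is proved about one regular fibre in the
open disc — planarity, connectedness, number of ends — transfers to all others).  For a PALF
`f : W → 𝔻²` (`Literature.Geometry.Symplectic.PALF`) any two regular fibres over points of the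
**open** unit disc are homeomorphic, and so are their interiors `F°(c) = F(c) ∩ int W`
(Ehresmann / Kas 1980 §1: the fibration is locally trivial over the regular values, which form a
connected open subset of the disc):

* `PALF.exists_freeBox` — a closed coordinate box about a regular value `c₀`, `‖c₀‖ < 1`, inside a
  disc of radius `< 1` and free of critical values;
* `PALF.exists_box_forall_nonempty_homeomorph` — **local triviality**: for `u` in an open box about
  `c₀`, `F(c₀) ≃ₜ F(u)` and `F°(c₀) ≃ₜ F°(u)` (the maps `Φ (u, ·)`, `Ψ` of
  `Literature.Geometry.Symplectic.PALF.BoxProduct`);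
* `PALF.isPreconnected_regularValues` — `{u | ‖u‖ < 1, u regular}` is preconnected (the open disc is
  homeomorphic to the plane, where complements of countable sets are path connected);
* `PALF.nonempty_homeomorph_fibre`, `PALF.nonempty_homeomorph_regularFibreOn` — **any two regular
  fibres (resp. their interiors) over the open disc are homeomorphic**
  (`IsPreconnected.induction₂`).

Everything is proved; no definitions, no named facts.

## References

* A. Kas, *On the handlebody decomposition associated to a Lefschetz fibration*, Pacific J.
  Math. 89 (1980), §1. [Kas1980]
* R. E. Gompf, A. I. Stipsicz, *4-manifolds and Kirby calculus*, GSM 20 (1999), §8.2.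
  [GompfStipsiczGSM1999]
-/

open scoped Manifold ContDiff Topology
open Set Function Filter Metric

noncomputable section

namespace Literature.Geometry.Symplectic

open Literature.Topology.FourManifolds

universe u

variable {W : Type u} [TopologicalSpace W] [ChartedSpace (EuclideanHalfSpace 4) W]
  [IsManifold (𝓡∂ 4) ∞ W] [T2Space W] [CompactSpace W]
  {o : SmoothOrientation (𝓡∂ 4) W} {b : BoundaryData (𝓡∂ 4) W (𝓡 3)}

namespace PALF

/-! ### §1 A box free of critical values -/

omit [T2Space W] [CompactSpace W] in
/-- About a regular value `c₀` of the open disc there is a closed coordinate box of positive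
half-width `Δ`, contained in a disc of radius `r < 1` and avoided by the (finitely many) critical
values. [cite: Kas1980, §1] -/
theorem exists_freeBox (P : PALF o b) {c₀ : EuclideanSpace ℝ (Fin 2)} (hc₀ : ‖c₀‖ < 1)
    (hc : c₀ ∉ P.f '' ↑P.crit) :
    ∃ Δ r : ℝ, 0 < Δ ∧ r < 1 ∧
      (∀ u : EuclideanSpace ℝ (Fin 2), (∀ i, |u i - c₀ i| ≤ Δ) → ‖u‖ ≤ r) ∧
      ∀ p ∈ P.crit, ∃ i, Δ < |P.f p i - c₀ i| := by
  obtain ⟨d, hd, hdle⟩ := P.exists_pos_forall_le_norm_sub hc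
  refine ⟨min (d / 4) ((1 - ‖c₀‖) / 4), (‖c₀‖ + 1) / 2, lt_min (by linarith) (by linarith),
    by linarith, fun u hu => ?_, fun p hp => ?_⟩
  · have h1 : ‖u - c₀‖ ≤ 2 * min (d / 4) ((1 - ‖c₀‖) / 4) :=
      norm_le_two_mul_of_forall_abs_le fun i => by rw [PiLp.sub_apply]; exact hu i
    have h2 := norm_le_norm_sub_add u c₀
    have h3 := min_le_right (d / 4) ((1 - ‖c₀‖) / 4)
    linarith
  · obtain ⟨i, hi⟩ := exists_half_norm_le_abs_apply (P.f p - c₀)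
    refine ⟨i, ?_⟩
    rw [PiLp.sub_apply] at hi
    have h1 := hdle p hp
    have h3 := min_le_left (d / 4) ((1 - ‖c₀‖) / 4)
    linarith

/-! ### §2 Local triviality -/

omit [T2Space W] [CompactSpace W] in
/-- `Φ (u, ·)` maps interior points to interior points. [folklore] -/
theorem BoxProduct.isInteriorPoint_Φ {c₀ : EuclideanSpace ℝ (Fin 2)} {δ : ℝ} {P : PALF o b}
    (B : BoxProduct P c₀ δ) (u : EuclideanSpace ℝ (Fin 2)) {y : W}
    (hy : (𝓡∂ 4).IsInteriorPoint y) : (𝓡∂ 4).IsInteriorPoint (B.Φ (u, y)) := by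
  by_contra h
  have hb : B.Φ (u, y) ∈ (𝓡∂ 4).boundary W :=
    ((𝓡∂ 4).isInteriorPoint_or_isBoundaryPoint (B.Φ (u, y))).resolve_left h
  exact ((𝓡∂ 4).isBoundaryPoint_iff_not_isInteriorPoint y).1 ((B.Φ_mem_boundary_iff u y).1 hb) hy

omit [T2Space W] [CompactSpace W] in
/-- `Ψ` maps interior points to interior points. [folklore] -/
theorem BoxProduct.isInteriorPoint_Ψ {c₀ : EuclideanSpace ℝ (Fin 2)} {δ : ℝ} {P : PALF o b}
    (B : BoxProduct P c₀ δ) {x : W} (hx : (𝓡∂ 4).IsInteriorPoint x) :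
    (𝓡∂ 4).IsInteriorPoint (B.Ψ x) := by
  by_contra h
  have hb : B.Ψ x ∈ (𝓡∂ 4).boundary W :=
    ((𝓡∂ 4).isInteriorPoint_or_isBoundaryPoint (B.Ψ x)).resolve_left h
  exact ((𝓡∂ 4).isBoundaryPoint_iff_not_isInteriorPoint x).1 ((B.Ψ_mem_boundary_iff x).1 hb) hx

/-- **Local triviality of a PALF over the regular values of the open disc** (Kas 1980, §1;
Gompf–Stipsicz 1999, §8.2): about a regular value `c₀`, `‖c₀‖ < 1`, there is an open coordinate
box over which every fibre `F(u)` is homeomorphic to `F(c₀)`, and every interior `F°(u)` to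
`F°(c₀)` — by the maps `Φ (u, ·)` and `Ψ` of the product structure `PALF.BoxProduct`.
[cite: Kas1980, §1] [cite: GompfStipsiczGSM1999, §8.2] -/
theorem exists_box_forall_nonempty_homeomorph (P : PALF o b) {c₀ : EuclideanSpace ℝ (Fin 2)}
    (hc₀ : ‖c₀‖ < 1) (hc : c₀ ∉ P.f '' ↑P.crit) :
    ∃ δ : ℝ, 0 < δ ∧ ∀ u : EuclideanSpace ℝ (Fin 2), (∀ i, |u i - c₀ i| < δ) →
      Nonempty ({x : W // P.f x = c₀} ≃ₜ {x : W // P.f x = u}) ∧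
      ∀ hu : u ∉ P.f '' ↑P.crit,
        Nonempty (RegularFibreOn (P.isRegularFibreOn_interior hc) ≃ₜ
          RegularFibreOn (P.isRegularFibreOn_interior hu)) := by
  obtain ⟨Δ, r, hΔ, hr, hbox, hcrit⟩ := P.exists_freeBox hc₀ hc
  obtain ⟨D⟩ := (nonempty_flowoutInput : Nonempty (FlowoutInput 3 W))
  obtain ⟨-, -, B, -, -⟩ := P.exists_boxProduct_level D le_rfl hr hbox hcrit
  refine ⟨Δ, hΔ, fun u hu => ⟨?_, fun hu' => ?_⟩⟩
  · have hΦc : Continuous fun y : {x : W // P.f x = c₀} => B.Φ (u, y.1) :=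
      B.contMDiff_Φ.continuous.comp (continuous_const.prodMk continuous_subtype_val)
    have hΨc : Continuous fun x : {x : W // P.f x = u} => B.Ψ x.1 :=
      B.contMDiff_Ψ.continuous.comp continuous_subtype_val
    have hbx : ∀ x : {x : W // P.f x = u}, ∀ i, |P.f x.1 i - c₀ i| < Δ := fun x i => by
      rw [x.2]; exact hu i
    refine ⟨{ toFun := fun y => ⟨B.Φ (u, y.1), B.f_Φ y.1 y.2 u hu⟩
              invFun := fun x => ⟨B.Ψ x.1, B.f_Ψ x.1 (hbx x)⟩
              left_inv := fun y => Subtype.ext (B.Ψ_Φ y.1 y.2 u hu)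
              right_inv := fun x => Subtype.ext ?_
              continuous_toFun := hΦc.subtype_mk _
              continuous_invFun := hΨc.subtype_mk _ }⟩
    show B.Φ (u, B.Ψ x.1) = x.1
    have h := B.Φ_Ψ x.1 (hbx x)
    rw [x.2] at h
    exact h
  · set hF := P.isRegularFibreOn_interior hc
    set hF' := P.isRegularFibreOn_interior hu'
    have hbx : ∀ q : RegularFibreOn hF', ∀ i, |P.f q.1 i - c₀ i| < Δ := fun q i => by
      rw [show P.f q.1 = u from q.2.1]; exact hu i
    have hΦc : Continuous fun q : RegularFibreOn hF => B.Φ (u, q.1) :=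
      B.contMDiff_Φ.continuous.comp (continuous_const.prodMk continuous_subtype_val)
    have hΨc : Continuous fun q : RegularFibreOn hF' => B.Ψ q.1 :=
      B.contMDiff_Ψ.continuous.comp continuous_subtype_val
    refine ⟨{ toFun := fun q => ⟨B.Φ (u, q.1), B.f_Φ q.1 q.2.1 u hu, B.isInteriorPoint_Φ u q.2.2⟩
              invFun := fun q => ⟨B.Ψ q.1, B.f_Ψ q.1 (hbx q), B.isInteriorPoint_Ψ q.2.2⟩
              left_inv := fun q => Subtype.ext (B.Ψ_Φ q.1 q.2.1 u hu)
              right_inv := fun q => Subtype.ext ?_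
              continuous_toFun := hΦc.subtype_mk _
              continuous_invFun := hΨc.subtype_mk _ }⟩
    show B.Φ (u, B.Ψ q.1) = q.1
    have h := B.Φ_Ψ q.1 (hbx q)
    rw [show P.f q.1 = u from q.2.1] at h
    exact h

/-! ### §3 The regular values of the open disc form a preconnected set -/

omit [T2Space W] [CompactSpace W] in
/-- **The regular values in the open unit disc form a preconnected set**: the open disc is
homeomorphic to the plane (`Homeomorph.unitBall`), in which the complement of a finite set is
path connected (`Set.Countable.isPathConnected_compl_of_one_lt_rank`). [folklore] -/
theorem isPreconnected_regularValues (P : PALF o b) :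
    IsPreconnected {u : EuclideanSpace ℝ (Fin 2) | ‖u‖ < 1 ∧ u ∉ P.f '' ↑P.crit} := by
  set e := (Homeomorph.unitBall : EuclideanSpace ℝ (Fin 2) ≃ₜ ball (0 : EuclideanSpace ℝ (Fin 2)) 1)
    with he
  set g : EuclideanSpace ℝ (Fin 2) → EuclideanSpace ℝ (Fin 2) := fun v => (e v : EuclideanSpace ℝ (Fin 2))
    with hg
  have hgc : Continuous g := continuous_subtype_val.comp e.continuous
  have hginj : Injective g := Subtype.val_injective.comp e.injective
  set T : Set (EuclideanSpace ℝ (Fin 2)) := g ⁻¹' (P.f '' ↑P.crit) with hT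
  have hTc : T.Countable :=
    ((P.crit.finite_toSet.image P.f).preimage hginj.injOn).countable
  have hrank : 1 < Module.rank ℝ (EuclideanSpace ℝ (Fin 2)) := by
    rw [← Module.finrank_eq_rank, finrank_euclideanSpace_fin]
    norm_num
  have hpc : IsPathConnected Tᶜ := hTc.isPathConnected_compl_of_one_lt_rank hrank
  have himage : g '' Tᶜ = {u : EuclideanSpace ℝ (Fin 2) | ‖u‖ < 1 ∧ u ∉ P.f '' ↑P.crit} := by
    ext u
    constructor
    · rintro ⟨v, hv, rfl⟩
      exact ⟨mem_ball_zero_iff.1 (e v).2, hv⟩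
    · rintro ⟨hu1, hu2⟩
      refine ⟨e.symm ⟨u, mem_ball_zero_iff.2 hu1⟩, ?_, ?_⟩
      · show g (e.symm ⟨u, _⟩) ∉ P.f '' ↑P.crit
        rw [hg]; simp only [Homeomorph.apply_symm_apply]; exact hu2
      · rw [hg]; simp only [Homeomorph.apply_symm_apply]
  rw [← himage]
  exact (hpc.image' hgc.continuousOn).isConnected.isPreconnected

/-! ### §4 Any two regular fibres over the open disc are homeomorphic -/

/-- The open coordinate box about `c₀` is a neighbourhood of `c₀`. [folklore] -/
theorem box_mem_nhds (c₀ : EuclideanSpace ℝ (Fin 2)) {δ : ℝ} (hδ : 0 < δ) :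
    {u : EuclideanSpace ℝ (Fin 2) | ∀ i, |u i - c₀ i| < δ} ∈ 𝓝 c₀ := by
  refine mem_of_superset (ball_mem_nhds c₀ hδ) fun u hu i => ?_
  rw [mem_ball, dist_eq_norm] at hu
  calc |u i - c₀ i| = ‖(u - c₀) i‖ := by rw [PiLp.sub_apply, Real.norm_eq_abs]
    _ ≤ ‖u - c₀‖ := PiLp.norm_apply_le (u - c₀) i
    _ < δ := hu

/-- **Any two regular fibres of a PALF over the open disc are homeomorphic** (Ehresmann; Kas 1980,
§1): local triviality over the preconnected set of regular values. [cite: Kas1980, §1] -/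
theorem nonempty_homeomorph_fibre (P : PALF o b) {c c' : EuclideanSpace ℝ (Fin 2)}
    (hc1 : ‖c‖ < 1) (hc : c ∉ P.f '' ↑P.crit) (hc'1 : ‖c'‖ < 1) (hc' : c' ∉ P.f '' ↑P.crit) :
    Nonempty ({x : W // P.f x = c} ≃ₜ {x : W // P.f x = c'}) := by
  refine P.isPreconnected_regularValues.induction₂
    (fun u u' => Nonempty ({x : W // P.f x = u} ≃ₜ {x : W // P.f x = u'}))
    (fun u hu => ?_) (fun u u' u'' _ _ _ h1 h2 => ?_) (fun u u' _ _ h => ?_) ⟨hc1, hc⟩ ⟨hc'1, hc'⟩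
  · obtain ⟨δ, hδ, hloc⟩ := P.exists_box_forall_nonempty_homeomorph hu.1 hu.2
    exact mem_nhdsWithin_of_mem_nhds (mem_of_superset (box_mem_nhds u hδ) fun u' hu' => (hloc u' hu').1)
  · obtain ⟨e1⟩ := h1
    obtain ⟨e2⟩ := h2
    exact ⟨e1.trans e2⟩
  · obtain ⟨e⟩ := h
    exact ⟨e.symm⟩

/-- **Any two interiors of regular fibres of a PALF over the open disc are homeomorphic**
(Ehresmann; Kas 1980, §1). [cite: Kas1980, §1] -/
theorem nonempty_homeomorph_regularFibreOn (P : PALF o b) {c c' : EuclideanSpace ℝ (Fin 2)}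
    (hc1 : ‖c‖ < 1) (hc : c ∉ P.f '' ↑P.crit) (hc'1 : ‖c'‖ < 1) (hc' : c' ∉ P.f '' ↑P.crit) :
    Nonempty (RegularFibreOn (P.isRegularFibreOn_interior hc) ≃ₜ
      RegularFibreOn (P.isRegularFibreOn_interior hc')) := by
  have h := P.isPreconnected_regularValues.induction₂
    (fun u u' => ∀ (hu : u ∉ P.f '' ↑P.crit) (hu' : u' ∉ P.f '' ↑P.crit),
      Nonempty (RegularFibreOn (P.isRegularFibreOn_interior hu) ≃ₜ
        RegularFibreOn (P.isRegularFibreOn_interior hu')))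
    (fun u hu => ?_) (fun u u' u'' _ hu' _ h1 h2 => ?_) (fun u u' _ _ h => ?_) ⟨hc1, hc⟩ ⟨hc'1, hc'⟩
  · exact h hc hc'
  · obtain ⟨δ, hδ, hloc⟩ := P.exists_box_forall_nonempty_homeomorph hu.1 hu.2
    refine mem_nhdsWithin_of_mem_nhds (mem_of_superset (box_mem_nhds u hδ) fun u' hu' => ?_)
    intro _ hu''
    exact (hloc u' hu').2 hu''
  · intro hu hu''
    obtain ⟨e1⟩ := h1 hu hu'.2
    obtain ⟨e2⟩ := h2 hu'.2 hu''
    exact ⟨e1.trans e2⟩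
  · intro hu' hu
    obtain ⟨e⟩ := h hu hu'
    exact ⟨e.symm⟩

end PALF

end Literature.Geometry.Symplectic

end
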